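import Summits.KontsevichZagierPeriods.KontsevichZagierPeriods.Theses.DefinableMoves

/-!
# Route DefinableMoves — `Assembly` (settles item stmt-KontsevichZagierPeriods-4086)

Assembly item of route `DefinableMoves` (problem `KontsevichZagierPeriods`):

  `IntegrabilityLocus → Transfer → RealKZ → KontsevichZagierPeriods`.

Pure logic over the two inline copies of the real-coefficient calculus (the `let`-prefixes of
`RealKZ` and `Transfer` are syntactically identical, so `let`-unfolding matches them): for
`ℚ`-rational `r`, `r'` of equal value, `RealKZ` puts `incl ([r] − [r'])` into the real move group
`Rel`, and `Transfer` pulls it back into `KZ.relations`, which is `KZ.Equivalent r r'` by definition.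
`IntegrabilityLocus` is carried as the route's first listed input (the printed-but-unvendored fact
on which the proof of `Transfer` rests); the deduction itself does not consume it. This is the same
term as the route's deciding theorem `closes`.

Sources: M. Kontsevich, D. Zagier, *Periods* (2001), §1.2 (Conjecture 1). Deliberately NOT here:
any of the three hypotheses (they are the route's cruxes / target).
-/

namespace Summit.KontsevichZagierPeriods.DefinableMoves

/-- Settles stmt-KontsevichZagierPeriods-4086 (`Assembly`, route `DefinableMoves`):
`IntegrabilityLocus → Transfer → RealKZ → KontsevichZagierPeriods`. Given `ℚ`-rational `r`, `r'`
with `r.value = r'.value`, `RealKZ` gives `incl ([r] − [r']) ∈ Rel` and `Transfer` gives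
`[r] − [r'] ∈ KZ.relations`, i.e. `KZ.Equivalent r r'`; `IntegrabilityLocus` is not used by the
deduction. [Kontsevich–Zagier 2001, §1.2] [folklore] -/
theorem assembly_proof :
    Summit.KontsevichZagierPeriods.KontsevichZagierPeriods.Theses.DefinableMoves.Assembly :=
  fun _ hT hR _ _ r r' hr hr' hv => hT _ (hR r r' hr hr' hv)

end Summit.KontsevichZagierPeriods.DefinableMoves
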